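import Summits.AtomisticToContinuum.HydrodynamicLimit.Theorems.CorrectorPressureDecay.Negative.Frame
import Summits.AtomisticToContinuum.HydrodynamicLimit.Theorems.BoltzmannGreenKubo.Negative.MazurFloor

/-!
# `CorrectorPressureDecay` — tools for (a.1′): tilted Jensen for unbounded tilts; momentum-tilted Gaussian integrals

Support file for crux `stmt-AtomisticToContinuum-14135` (`AntiMazurCoboundaries.CorrectorPressureDecay`, "X"),
written by the standing disprover (cdisprove seat, cycle 2); consumed by `Negative/OrthMomentum.lean`.

* §1 `tilted_jensen'` — Jensen under the tilted law in integrability form (for unbounded tilts such as `βP₀`),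
  `measurePreserving_tilted_ae` — tilting by an a.e.-invariant potential keeps a measure-preserving map so;
* §2 one-dimensional Gaussian facts: Cameron–Martin shift `integral_mul_exp_mul_gaussianReal(')`,
  `integral_cos_gaussianReal = e^{−1/2}`, `integral_sin_gaussianReal = 0` (characteristic function),
  `integral_sin_mul_exp_gaussianReal`, `integral_id_mul_exp_gaussianReal`;
* §3 lift to `ℝ³` (`integral_coord_stdGaussian`, via the sibling crux's `measurePreserving_coord`) and to the
  `N`-body product Gaussian: mgf `integral_exp_mul_sum_coord`, one distinguished factor
  `integral_mul_exp_mul_sum_coord`, `integrable_exp_mul_sum_coord`.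

All `[folklore]`.
-/

noncomputable section

open MeasureTheory ProbabilityTheory Set Filter Topology
open scoped ENNReal

namespace Summit.AtomisticToContinuum.HydrodynamicLimit.Theorems.CorrectorPressureDecayNegative.OrthMomentum

open Literature.MathematicalPhysics.KineticTheory (T3 V3 hsDiameter localGibbsLaw localGibbsMeasure
  localGibbsProfile localGibbsLaw_eq isProbabilityMeasure_localGibbsLaw localGibbsMeasure_absolutelyContinuous)
open Literature.Analysis.FluidPDE (HardSphereFlow Config)
open Summit.AtomisticToContinuum.HydrodynamicLimit.Theorems.BoltzmannGreenKuboOrthMomentum (velOf measurable_velOf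
  integral_velOf_localGibbsLaw integrable_velOf_localGibbsLaw Pobs Pobs_flow measurable_Pobs measurePreserving_coord
  integral_exp_mul_gaussianReal)

variable {X : Type*} [MeasurableSpace X]

/-! ## §1 Tilted Jensen, integrability form; a.e.-invariant tilts -/

/-- Bounded measurable real functions have integrable exponentials on a finite measure space. [folklore] -/
theorem integrable_exp_of_abs_le {μ : Measure X} [IsFiniteMeasure μ] {V : X → ℝ} (hVm : Measurable V) {C : ℝ}
    (hV : ∀ x, |V x| ≤ C) : Integrable (fun x => Real.exp (V x)) μ := by
  refine (integrable_const (Real.exp C)).mono' (Real.continuous_exp.measurable.comp hVm).aestronglyMeasurable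
    (ae_of_all _ fun x => ?_)
  rw [Real.norm_eq_abs, abs_of_pos (Real.exp_pos _)]
  exact Real.exp_le_exp.2 ((le_abs_self _).trans (hV x))

/-- Bounded measurable real functions are integrable on a finite measure space. [folklore] -/
theorem integrable_of_abs_le {μ : Measure X} [IsFiniteMeasure μ] {V : X → ℝ} (hVm : Measurable V) {C : ℝ}
    (hV : ∀ x, |V x| ≤ C) : Integrable V μ :=
  (integrable_const C).mono' hVm.aestronglyMeasurable (ae_of_all _ fun x => by simpa [Real.norm_eq_abs] using hV x)

/-- **Jensen under the tilted law, integrability form** (for unbounded tilts such as `βP₀`):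
`(∫ e^V dμ) · exp(∫ (Y − V) d(μ.tilted V)) ≤ ∫ e^Y dμ`. [folklore] -/
theorem tilted_jensen' {μ : Measure X} [IsProbabilityMeasure μ] {V Y : X → ℝ}
    (hV : Integrable (fun x => Real.exp (V x)) μ) (hY : Integrable (fun x => Real.exp (Y x)) μ)
    (hYV : Integrable (fun x => Y x - V x) (μ.tilted V)) :
    (∫ x, Real.exp (V x) ∂μ) * Real.exp (∫ x, (Y x - V x) ∂(μ.tilted V)) ≤ ∫ x, Real.exp (Y x) ∂μ := by
  haveI : IsProbabilityMeasure (μ.tilted V) := isProbabilityMeasure_tilted hV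
  set Z : ℝ := ∫ x, Real.exp (V x) ∂μ with hZ
  have hZpos : 0 < Z := by
    rw [hZ]; exact integral_exp_pos hV
  have hexpDint : Integrable (fun x => Real.exp (Y x - V x)) (μ.tilted V) := by
    rw [integrable_tilted_iff hV]
    refine hY.congr (ae_of_all _ fun x => ?_)
    simp only [smul_eq_mul, Real.exp_sub]
    rw [mul_div_cancel₀ _ (Real.exp_pos _).ne']
  have hJ := ConvexOn.map_integral_le convexOn_exp Real.continuous_exp.continuousOn isClosed_univ
    (ae_of_all _ fun x => mem_univ _) hYV hexpDint
  have hcomp : ∫ x, Real.exp (Y x - V x) ∂(μ.tilted V) = Z⁻¹ * ∫ x, Real.exp (Y x) ∂μ := by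
    rw [integral_tilted]
    simp_rw [smul_eq_mul, ← hZ]
    rw [← integral_const_mul]
    refine integral_congr_ae (ae_of_all _ fun x => ?_)
    show Real.exp (V x) / Z * Real.exp (Y x - V x) = Z⁻¹ * Real.exp (Y x)
    rw [Real.exp_sub, div_eq_mul_inv, mul_comm (Real.exp (V x)) Z⁻¹, mul_assoc,
      mul_div_cancel₀ _ (Real.exp_pos _).ne']
  rw [hcomp] at hJ
  have := mul_le_mul_of_nonneg_left hJ hZpos.le
  rwa [← mul_assoc, mul_inv_cancel₀ hZpos.ne', one_mul] at this

/-- Tilting by an a.e.-`T`-invariant potential keeps a measure-preserving `T` measure-preserving. [folklore] -/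
theorem measurePreserving_tilted_ae {μ : Measure X} {T : X → X} (hT : MeasurePreserving T μ μ)
    {V : X → ℝ} (hVm : Measurable V) (hinv : ∀ᵐ x ∂μ, V (T x) = V x) :
    MeasurePreserving T (μ.tilted V) (μ.tilted V) := by
  refine ⟨hT.measurable, ?_⟩
  set ρ : X → ℝ≥0∞ := fun x => ENNReal.ofReal (Real.exp (V x) / ∫ x, Real.exp (V x) ∂μ) with hρ
  have hρm : Measurable ρ := ((Real.continuous_exp.measurable.comp hVm).div_const _).ennreal_ofReal
  have htilt : μ.tilted V = μ.withDensity ρ := rfl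
  ext A hA
  rw [Measure.map_apply hT.measurable hA, htilt, withDensity_apply _ (hT.measurable hA), withDensity_apply _ hA,
    ← lintegral_indicator (hT.measurable hA), ← lintegral_indicator hA]
  have hae : (fun x => (T ⁻¹' A).indicator ρ x) =ᵐ[μ] fun x => (A.indicator ρ) (T x) := by
    filter_upwards [hinv] with x hx
    simp only [Set.indicator, mem_preimage, hρ, hx]
    rfl
  rw [lintegral_congr_ae hae, hT.lintegral_comp (hρm.indicator hA)]

/-! ## §2 One-dimensional Gaussian facts -/

/-- **Cameron–Martin in one dimension**: `∫ h(x) e^{βx} dγ₁(x) = e^{β²/2} ∫ h dN(β, 1)`. [folklore] -/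
theorem integral_mul_exp_mul_gaussianReal (h : ℝ → ℝ) (β : ℝ) :
    ∫ x, h x * Real.exp (β * x) ∂gaussianReal 0 1 = Real.exp (β ^ 2 / 2) * ∫ x, h x ∂gaussianReal β 1 := by
  rw [integral_gaussianReal_eq_integral_smul one_ne_zero, integral_gaussianReal_eq_integral_smul one_ne_zero,
    ← integral_const_mul]
  refine integral_congr_ae (ae_of_all _ fun x => ?_)
  simp only [smul_eq_mul, gaussianPDFReal_def, NNReal.coe_one, mul_one, sub_zero]
  have : Real.exp (-x ^ 2 / 2) * Real.exp (β * x) = Real.exp (β ^ 2 / 2) * Real.exp (-(x - β) ^ 2 / 2) := by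
    rw [← Real.exp_add, ← Real.exp_add]
    congr 1
    ring
  calc (Real.sqrt (2 * Real.pi))⁻¹ * Real.exp (-x ^ 2 / 2) * (h x * Real.exp (β * x))
      = (Real.sqrt (2 * Real.pi))⁻¹ * (Real.exp (-x ^ 2 / 2) * Real.exp (β * x)) * h x := by ring
    _ = Real.exp (β ^ 2 / 2) * ((Real.sqrt (2 * Real.pi))⁻¹ * Real.exp (-(x - β) ^ 2 / 2) * h x) := by
        rw [this]; ring

/-- … and with the shift made explicit: `∫ h(x) e^{βx} dγ₁ = e^{β²/2} ∫ h(x + β) dγ₁`. [folklore] -/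
theorem integral_mul_exp_mul_gaussianReal' {h : ℝ → ℝ} (hh : Measurable h) (β : ℝ) :
    ∫ x, h x * Real.exp (β * x) ∂gaussianReal 0 1 = Real.exp (β ^ 2 / 2) * ∫ x, h (x + β) ∂gaussianReal 0 1 := by
  rw [integral_mul_exp_mul_gaussianReal]
  congr 1
  have := gaussianReal_map_add_const (μ := 0) (v := 1) β
  rw [zero_add] at this
  rw [← this, integral_map (measurable_add_const β).aemeasurable hh.aestronglyMeasurable]

/-- `E cos Z = e^{−1/2}` for `Z ∼ N(0,1)` (real part of the characteristic function at `1`). [folklore] -/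
theorem integral_cos_gaussianReal : ∫ x, Real.cos x ∂gaussianReal 0 1 = Real.exp (-(1 / 2)) := by
  have h := charFun_gaussianReal (μ := 0) (v := 1) 1
  rw [charFun_apply_real] at h
  have hint : Integrable (fun x : ℝ => Complex.exp (((1 : ℝ) : ℂ) * x * Complex.I)) (gaussianReal 0 1) := by
    refine (integrable_const (1 : ℝ)).mono' (by fun_prop) (ae_of_all _ fun x => ?_)
    rw [Complex.norm_exp]
    simp
  have hre := integral_re hint
  rw [h] at hre
  simp only [Complex.ofReal_one, one_mul, Complex.ofReal_zero, mul_zero, zero_mul, NNReal.coe_one,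
    one_pow, mul_one, zero_sub] at hre
  have h1 : ∀ x : ℝ, RCLike.re (Complex.exp (↑x * Complex.I)) = Real.cos x := fun x => Complex.exp_ofReal_mul_I_re x
  simp_rw [h1] at hre
  rw [hre]
  have : (-((1 : ℂ) / 2)) = ((-(1 / 2) : ℝ) : ℂ) := by push_cast; ring
  rw [this, RCLike.re_eq_complex_re, Complex.exp_ofReal_re]

/-- `E sin Z = 0` for `Z ∼ N(0,1)` (imaginary part of the characteristic function at `1`). [folklore] -/
theorem integral_sin_gaussianReal : ∫ x, Real.sin x ∂gaussianReal 0 1 = 0 := by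
  have h := charFun_gaussianReal (μ := 0) (v := 1) 1
  rw [charFun_apply_real] at h
  have hint : Integrable (fun x : ℝ => Complex.exp (((1 : ℝ) : ℂ) * x * Complex.I)) (gaussianReal 0 1) := by
    refine (integrable_const (1 : ℝ)).mono' (by fun_prop) (ae_of_all _ fun x => ?_)
    rw [Complex.norm_exp]
    simp
  have him := integral_im hint
  rw [h] at him
  simp only [Complex.ofReal_one, one_mul, Complex.ofReal_zero, mul_zero, zero_mul, NNReal.coe_one,
    one_pow, mul_one, zero_sub] at him
  have h1 : ∀ x : ℝ, RCLike.im (Complex.exp (↑x * Complex.I)) = Real.sin x := fun x => Complex.exp_ofReal_mul_I_im x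
  simp_rw [h1] at him
  rw [him]
  have : (-((1 : ℂ) / 2)) = ((-(1 / 2) : ℝ) : ℂ) := by push_cast; ring
  rw [this, RCLike.im_eq_complex_im, Complex.exp_ofReal_im]

/-- `E sin(Z + β) = e^{−1/2} sin β`. [folklore] -/
theorem integral_sin_add_gaussianReal (β : ℝ) :
    ∫ x, Real.sin (x + β) ∂gaussianReal 0 1 = Real.exp (-(1 / 2)) * Real.sin β := by
  simp_rw [Real.sin_add]
  have hs : Integrable (fun x => Real.sin x * Real.cos β) (gaussianReal 0 1) :=
    (integrable_of_abs_le Real.continuous_sin.measurable (C := 1) fun x => Real.abs_sin_le_one x).mul_const _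
  have hc : Integrable (fun x => Real.cos x * Real.sin β) (gaussianReal 0 1) :=
    (integrable_of_abs_le Real.continuous_cos.measurable (C := 1) fun x => Real.abs_cos_le_one x).mul_const _
  rw [integral_add hs hc, integral_mul_const, integral_mul_const, integral_sin_gaussianReal, integral_cos_gaussianReal]
  ring

/-- `∫ sin(x) e^{βx} dγ₁ = e^{β²/2} e^{−1/2} sin β`. [folklore] -/
theorem integral_sin_mul_exp_gaussianReal (β : ℝ) :
    ∫ x, Real.sin x * Real.exp (β * x) ∂gaussianReal 0 1 = Real.exp (β ^ 2 / 2) * (Real.exp (-(1 / 2)) * Real.sin β) := by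
  rw [integral_mul_exp_mul_gaussianReal' Real.continuous_sin.measurable, integral_sin_add_gaussianReal]

/-- `∫ x e^{βx} dγ₁ = e^{β²/2} β`. [folklore] -/
theorem integral_id_mul_exp_gaussianReal (β : ℝ) :
    ∫ x, x * Real.exp (β * x) ∂gaussianReal 0 1 = Real.exp (β ^ 2 / 2) * β := by
  rw [integral_mul_exp_mul_gaussianReal, integral_id_gaussianReal]

/-! ## §3 Lifting to `ℝ³` and to the `N`-body product Gaussian -/

/-- Functions of one coordinate integrate against the one-dimensional Gaussian. [folklore] -/
theorem integral_coord_stdGaussian (k : Fin 3) {h : ℝ → ℝ} (hh : Measurable h) :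
    ∫ w, h (w k) ∂stdGaussian V3 = ∫ x, h x ∂gaussianReal 0 1 := by
  have hmp := measurePreserving_coord k
  rw [← hmp.map_eq, integral_map hmp.measurable.aemeasurable hh.aestronglyMeasurable]

/-- The product standard Gaussian on `(ℝ³)^{N+1}`. -/
abbrev piGauss (N : ℕ) : Measure (Fin (N + 1) → V3) := Measure.pi fun _ : Fin (N + 1) => stdGaussian V3

/-- Moment generating function of `βΣᵢ(vᵢ)₀`: `∫ e^{βΣ(vᵢ)₀} d⊗γ = (e^{β²/2})^{N+1}`. [folklore] -/
theorem integral_exp_mul_sum_coord (N : ℕ) (β : ℝ) :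
    ∫ v, Real.exp (β * ∑ i, v i 0) ∂piGauss N = Real.exp (β ^ 2 / 2) ^ (N + 1) := by
  have : ∀ v : Fin (N + 1) → V3, Real.exp (β * ∑ i, v i 0) = ∏ i, Real.exp (β * v i 0) := by
    intro v
    rw [Finset.mul_sum, Real.exp_sum]
  simp_rw [this]
  rw [integral_fintype_prod_eq_prod (fun (_ : Fin (N + 1)) (w : V3) => Real.exp (β * w 0))]
  simp only [Finset.prod_const, Finset.card_univ, Fintype.card_fin]
  congr 1
  rw [integral_coord_stdGaussian 0 (by fun_prop : Measurable fun x : ℝ => Real.exp (β * x)),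
    integral_exp_mul_gaussianReal]

/-- One distinguished factor: `∫ h((vᵢ)₀) e^{βΣ(vⱼ)₀} d⊗γ = (∫ h e^{β·} dγ₁)·(e^{β²/2})^N`. [folklore] -/
theorem integral_mul_exp_mul_sum_coord (N : ℕ) (β : ℝ) {h : ℝ → ℝ} (hh : Measurable h) (i : Fin (N + 1)) :
    ∫ v, h (v i 0) * Real.exp (β * ∑ j, v j 0) ∂piGauss N =
      (∫ x, h x * Real.exp (β * x) ∂gaussianReal 0 1) * Real.exp (β ^ 2 / 2) ^ N := by
  classical
  set f : Fin (N + 1) → V3 → ℝ := fun j w => (if j = i then h (w 0) else 1) * Real.exp (β * w 0) with hf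
  have hprod : ∀ v : Fin (N + 1) → V3, h (v i 0) * Real.exp (β * ∑ j, v j 0) = ∏ j, f j (v j) := by
    intro v
    rw [hf]
    simp only
    rw [Finset.prod_mul_distrib, Finset.prod_ite_eq' Finset.univ i (fun j => h (v j 0)), if_pos (Finset.mem_univ i),
      Finset.mul_sum, Real.exp_sum]
  simp_rw [hprod]
  rw [integral_fintype_prod_eq_prod f]
  have hsplit : ∏ j, ∫ w, f j w ∂stdGaussian V3 =
      (∫ w, f i w ∂stdGaussian V3) * ∏ j ∈ Finset.univ.erase i, ∫ w, f j w ∂stdGaussian V3 :=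
    (Finset.mul_prod_erase Finset.univ (fun j => ∫ w, f j w ∂stdGaussian V3) (Finset.mem_univ i)).symm
  rw [hsplit]
  have hi : ∫ w, f i w ∂stdGaussian V3 = ∫ x, h x * Real.exp (β * x) ∂gaussianReal 0 1 := by
    simp only [hf, if_true]
    exact integral_coord_stdGaussian 0 (h := fun x => h x * Real.exp (β * x))
      (hh.mul (by fun_prop : Measurable fun x : ℝ => Real.exp (β * x)))
  have hj : ∀ j ∈ Finset.univ.erase i, ∫ w, f j w ∂stdGaussian V3 = Real.exp (β ^ 2 / 2) := by
    intro j hj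
    have hji : j ≠ i := Finset.ne_of_mem_erase hj
    simp only [hf, if_neg hji, one_mul]
    rw [integral_coord_stdGaussian 0 (by fun_prop : Measurable fun x : ℝ => Real.exp (β * x)),
      integral_exp_mul_gaussianReal]
  rw [hi, Finset.prod_congr rfl hj, Finset.prod_const, Finset.card_erase_of_mem (Finset.mem_univ i),
    Finset.card_univ, Fintype.card_fin, Nat.add_sub_cancel]

/-- Integrability of the momentum mgf family on the product Gaussian. [folklore] -/
theorem integrable_exp_mul_sum_coord (N : ℕ) (β : ℝ) :
    Integrable (fun v : Fin (N + 1) → V3 => Real.exp (β * ∑ i, v i 0)) (piGauss N) := by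
  have : (fun v : Fin (N + 1) → V3 => Real.exp (β * ∑ i, v i 0)) =
      fun v => ∏ i, (fun (_ : Fin (N + 1)) (w : V3) => Real.exp (β * w 0)) i (v i) := by
    funext v
    rw [Finset.mul_sum, Real.exp_sum]
  rw [this]
  refine Integrable.fintype_prod (f := fun (_ : Fin (N + 1)) (w : V3) => Real.exp (β * w 0))
    (μ := fun _ : Fin (N + 1) => stdGaussian V3) fun i => ?_
  have hmp := measurePreserving_coord (0 : Fin 3)
  exact (hmp.integrable_comp (by fun_prop : Measurable fun x : ℝ => Real.exp (β * x)).aestronglyMeasurable).2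
    (integrable_exp_mul_gaussianReal β)

end Summit.AtomisticToContinuum.HydrodynamicLimit.Theorems.CorrectorPressureDecayNegative.OrthMomentum

end
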